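import Summits.AtomisticToContinuum.FouriersLaw.Theses.HonestZwanzig
import Summits.AtomisticToContinuum.FouriersLaw.Theorems.HonestZwanzigParityStaticsSiteEnergyGenerator
import Summits.AtomisticToContinuum.FouriersLaw.Theorems.HonestZwanzigParityStaticsGibbsParity
import Summits.AtomisticToContinuum.FouriersLaw.Theorems.HonestZwanzigParityStaticsSiteEnergyBounds

/-!
# `HonestZwanzig.ParityStatics` (stmt-AtomisticToContinuum-12699): Euler block vanishes, contact damping explicit

Item `ParityStatics` of route `HonestZwanzig` (sub-problem `FouriersLaw`). For the pinned anharmonic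
chain `P = pinnedChain ω₂ lam β γ` (all parameters `> 0`), `T > 0`, `N ≥ 2`, the Gibbs measure
`μ = gibbsMeasure N T = Z⁻¹ e^{-H/T} dq dp` and the symmetrically split site energies
`e_x = p_x²/2 + U(q_x) + ½V(q_{x+1} - q_x) + ½V(q_x - q_{x-1})`:

* `∫ e_x j_b dμ = 0` for all sites `x` and bonds `b` — `e_x` is even and `j_b` odd under momentum
  reversal `(q,p) ↦ (q,-p)`, which preserves `e^{-H/T} dq dp` (so the "Euler block" `⟨e, j⟩` of the
  Feshbach–Zwanzig projection vanishes);
* `Cov_μ(e_x, L e_y) = -γT² · [x = y ∈ {0, N-1}]` — by the local energy balance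
  `L e_y = j_{y-1} - j_y + [y ∈ ∂] γ (T - p_y²)` (`pinnedChain_generator_splitSiteEnergy`), parity kills the
  current terms and `μ(L e_y) = 0`, and the contact term is the Gaussian computation
  `Cov(e_x, T - p_y²) = -[x = y] Var(p_y²)/2 = -[x = y] T²` (`p_y ~ N(0,T)` independent of the rest:
  `E p² = T`, `E p⁴ = 3T²`, `∫ G(q) p_y² = T ∫ G`).

Assembly of the helper files `HonestZwanzigParityStaticsSiteEnergyGenerator` (the generator identity),
`HonestZwanzigParityStaticsGibbsParity` (parity, one-momentum Gaussian integration by parts, bookkeeping)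
and `HonestZwanzigParityStaticsSiteEnergyBounds` (integrability), plus the Gaussian momentum moments of
`SubdiffusiveBondHeat` (`pinnedChain_integral_momentum_pow_add_two`, `integral_siteEnergy_combination`).
Sources: Bonetto–Lebowitz–Rey-Bellet 2000 §4.1, §5.2; Chu–Li 2019 §3, Thm 3 (parity-vanishing
Markovian term of the Mori–Zwanzig projection onto block energies).
-/

noncomputable section

open MeasureTheory

namespace Summit.AtomisticToContinuum.FouriersLaw.Theorems.HonestZwanzig

open Literature.MathematicalPhysics.KineticTheory.HeatConduction
open Summit.AtomisticToContinuum.FouriersLaw.Theorems.SubdiffusiveBondHeat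

/-- Collecting the two bath indicators: `D + [c₀] γ (T - p) + [c₁] γ (T - p) = D + ([c₀] + [c₁]) γ (T - p)`.
[folklore] -/
theorem add_bath_ite (D g T p : ℝ) (c0 c1 : Prop) [Decidable c0] [Decidable c1] :
    D + (if c0 then g * (T - p) else 0) + (if c1 then g * (T - p) else 0) =
      D + ((if c0 then (1 : ℝ) else 0) + (if c1 then (1 : ℝ) else 0)) * g * (T - p) := by
  split_ifs <;> ring

section Pinned

variable {ω₂ lam β : ℝ}

/-- `∫ p_y² e^{-H/T} = T ∫ e^{-H/T}` (`p_y ~ N(0,T)` under the Gibbs state). [folklore] -/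
theorem pinnedChain_integral_sq_momentum_mul_gibbsDensity (hω : 0 < ω₂) (hl : 0 ≤ lam) (hβ : 0 ≤ β)
    (γ : ℝ) (N : ℕ) {T : ℝ} (hT : 0 < T) (y : Fin N) :
    ∫ z, z.2 y ^ 2 * (pinnedChain ω₂ lam β γ).gibbsDensity N T z =
      T * ∫ z, (pinnedChain ω₂ lam β γ).gibbsDensity N T z := by
  have m2 := pinnedChain_integral_momentum_pow_add_two hω hl hβ γ N hT y (k := 0) (Nat.zero_le _)
  have h0 : ∫ x, x.2 y ^ 0 * (pinnedChain ω₂ lam β γ).gibbsDensity N T x =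
      ∫ x, (pinnedChain ω₂ lam β γ).gibbsDensity N T x := by
    simp
  simp only [Nat.cast_zero, zero_add, mul_one] at m2
  rw [h0] at m2
  exact m2

/-- `∫ p_y⁴ e^{-H/T} = 3T ∫ p_y² e^{-H/T}` (`p_y ~ N(0,T)` under the Gibbs state). [folklore] -/
theorem pinnedChain_integral_fourth_momentum_mul_gibbsDensity (hω : 0 < ω₂) (hl : 0 ≤ lam)
    (hβ : 0 ≤ β) (γ : ℝ) (N : ℕ) {T : ℝ} (hT : 0 < T) (y : Fin N) :
    ∫ z, z.2 y ^ 4 * (pinnedChain ω₂ lam β γ).gibbsDensity N T z =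
      T * (2 + 1) * ∫ z, z.2 y ^ 2 * (pinnedChain ω₂ lam β γ).gibbsDensity N T z := by
  have m4 := pinnedChain_integral_momentum_pow_add_two hω hl hβ γ N hT y (k := 2) le_rfl
  simp only [Nat.reduceAdd, Nat.cast_ofNat] at m4
  exact m4

/-- **The generator of a site energy has Gibbs mean zero**: `∫ (L_{T,T} e_y) e^{-H/T} dq dp = 0` for the
split site energy `e_y` of the pinned chain (every `N`, `ω₂ > 0`, `lam, β ≥ 0`, `T > 0`): the current
part `j_{y-1} - j_y` is odd under momentum reversal and the bath part `[y ∈ ∂] γ (T - p_y²)` has mean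
zero since `∫ p_y² e^{-H/T} = T ∫ e^{-H/T}`. (Stationarity of the Gibbs state, checked by hand on this
observable.) [folklore] -/
theorem pinnedChain_integral_generator_splitSiteEnergy_mul_gibbsDensity (hω : 0 < ω₂) (hl : 0 ≤ lam)
    (hβ : 0 ≤ β) (γ : ℝ) (N : ℕ) {T : ℝ} (hT : 0 < T) (y : Fin N) :
    ∫ z, (pinnedChain ω₂ lam β γ).generator N T T (fun w : PhaseSpace N => w.2 y ^ 2 / 2 +
        (pinnedChain ω₂ lam β γ).U (w.1 y) + ∑ j : Fin N,
          ((if j.val = y.val + 1 then (pinnedChain ω₂ lam β γ).V (w.1 j - w.1 y) / 2 else 0) +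
            (if y.val = j.val + 1 then (pinnedChain ω₂ lam β γ).V (w.1 y - w.1 j) / 2 else 0))) z *
      (pinnedChain ω₂ lam β γ).gibbsDensity N T z = 0 := by
  simp only [pinnedChain_generator_splitSiteEnergy, add_bath_ite]
  exact mean_combination
    (pinnedChain_integrable_bondCurrentDivergence_mul_gibbsDensity hω hl hβ γ N hT y)
    (pinnedChain_integral_odd_mul_gibbsDensity ω₂ lam β γ N T fun z =>
      bondCurrentDivergence_neg_momentum _ N y z)
    (pinnedChain_integrable_gibbsDensity hω hl hβ γ N hT)
    (pinnedChain_integrable_momentum_pow_mul_gibbsDensity hω hl hβ γ N hT y (k := 2) (by norm_num))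
    (pinnedChain_integral_sq_momentum_mul_gibbsDensity hω hl hβ γ N hT y)

/-- **The static covariance `∫ e_x (L e_y) e^{-H/T}`** for the split site energies of the pinned chain
(every `N`, `ω₂ > 0`, `lam, β ≥ 0`, `T > 0`):
`∫ e_x (L_{T,T} e_y) e^{-H/T} = -[x = y] ([y = 0] + [y = N-1]) γ T² ∫ e^{-H/T}`.
The current part of `L e_y` drops by parity (`e_x` even, `j_b` odd); for the bath part,
`∫ e_x (T - p_y²) e^{-H/T} = 0` if `x ≠ y` (`e_x` does not involve `p_y`: Gaussian integration by parts),
and `= (T·T/2 - 3T²/2) ∫ e^{-H/T} = -T² ∫ e^{-H/T}` if `x = y` (the position part of `e_y` again drops).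
[folklore] -/
theorem pinnedChain_integral_splitSiteEnergy_mul_generator_mul_gibbsDensity (hω : 0 < ω₂)
    (hl : 0 ≤ lam) (hβ : 0 ≤ β) (γ : ℝ) (N : ℕ) {T : ℝ} (hT : 0 < T) (x y : Fin N) :
    ∫ z, (z.2 x ^ 2 / 2 + (pinnedChain ω₂ lam β γ).U (z.1 x) + ∑ j : Fin N,
        ((if j.val = x.val + 1 then (pinnedChain ω₂ lam β γ).V (z.1 j - z.1 x) / 2 else 0) +
          (if x.val = j.val + 1 then (pinnedChain ω₂ lam β γ).V (z.1 x - z.1 j) / 2 else 0))) *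
      (pinnedChain ω₂ lam β γ).generator N T T (fun w : PhaseSpace N => w.2 y ^ 2 / 2 +
        (pinnedChain ω₂ lam β γ).U (w.1 y) + ∑ j : Fin N,
          ((if j.val = y.val + 1 then (pinnedChain ω₂ lam β γ).V (w.1 j - w.1 y) / 2 else 0) +
            (if y.val = j.val + 1 then (pinnedChain ω₂ lam β γ).V (w.1 y - w.1 j) / 2 else 0))) z *
      (pinnedChain ω₂ lam β γ).gibbsDensity N T z =
      -((if x = y then ((if y.val = 0 then (1 : ℝ) else 0) + (if y.val = N - 1 then (1 : ℝ) else 0)) *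
          (pinnedChain ω₂ lam β γ).γ * T ^ 2 else 0) *
        ∫ z, (pinnedChain ω₂ lam β γ).gibbsDensity N T z) := by
  simp only [pinnedChain_generator_splitSiteEnergy, add_bath_ite]
  -- parity of the current part and integrability
  have f1i := pinnedChain_integrable_splitSiteEnergy_mul_bondCurrentDivergence_mul_gibbsDensity
    hω hl hβ γ N hT x y
  have f1z := pinnedChain_integral_even_mul_odd_mul_gibbsDensity ω₂ lam β γ N T
    (E := fun z : PhaseSpace N => z.2 x ^ 2 / 2 + (pinnedChain ω₂ lam β γ).U (z.1 x) + ∑ j : Fin N,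
      ((if j.val = x.val + 1 then (pinnedChain ω₂ lam β γ).V (z.1 j - z.1 x) / 2 else 0) +
        (if x.val = j.val + 1 then (pinnedChain ω₂ lam β γ).V (z.1 x - z.1 j) / 2 else 0)))
    (J := fun z : PhaseSpace N => ∑ b : Fin N,
      ((if y.val = b.val + 1 then (pinnedChain ω₂ lam β γ).bondCurrent N b z else 0) -
        (if b = y then (pinnedChain ω₂ lam β γ).bondCurrent N b z else 0)))
    (fun z => splitSiteEnergy_neg_momentum _ N x z) (fun z => bondCurrentDivergence_neg_momentum _ N y z)
  have hH0 : ∀ z : PhaseSpace N, 0 ≤ (pinnedChain ω₂ lam β γ).hamiltonian N z := fun z =>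
    pinnedChain_hamiltonian_nonneg hω.le hl hβ γ N z
  rcases eq_or_ne x y with hxy | hxy
  · -- diagonal: `Cov(e_y, T - p_y²) = -T²`
    subst hxy
    rw [if_pos rfl]
    set c₀ : ℝ := (if x.val = 0 then (1 : ℝ) else 0) + (if x.val = N - 1 then (1 : ℝ) else 0)
    have f2i := pinnedChain_integrable_momentum_pow_mul_gibbsDensity hω hl hβ γ N hT x (k := 2)
      (by norm_num)
    have f3i := pinnedChain_integrable_momentum_pow_mul_gibbsDensity hω hl hβ γ N hT x (k := 4) le_rfl
    have m2 := pinnedChain_integral_sq_momentum_mul_gibbsDensity hω hl hβ γ N hT x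
    have m4 := pinnedChain_integral_fourth_momentum_mul_gibbsDensity hω hl hβ γ N hT x
    -- the position part `G(q) = U(q_x) + half bonds`: Gaussian integration by parts in `p_x`
    obtain ⟨iG, iGp2, hIBP⟩ := pinnedChain_integral_posObs_sq_momentum_mul_gibbsDensity hω hl hβ γ N
      hT x (G := fun q : Fin N → ℝ => (pinnedChain ω₂ lam β γ).U (q x) + ∑ j : Fin N,
        ((if j.val = x.val + 1 then (pinnedChain ω₂ lam β γ).V (q j - q x) / 2 else 0) +
          (if x.val = j.val + 1 then (pinnedChain ω₂ lam β γ).V (q x - q j) / 2 else 0)))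
      (pinnedChain_continuous_potSiteEnergy ω₂ lam β γ N x) (C := (N : ℝ) + 1) (by positivity)
      (fun z => by
        rw [abs_of_nonneg (pinnedChain_potSiteEnergy_nonneg hω.le hl hβ γ N x z.1)]
        refine (pinnedChain_potSiteEnergy_le hω.le hl hβ γ N x z).trans ?_
        have : (0 : ℝ) ≤ (N : ℝ) + 1 := by positivity
        nlinarith [mul_nonneg this (hH0 z)])
    have key := integral_siteEnergy_combination (c := -(c₀ * (pinnedChain ω₂ lam β γ).γ)) (T := T)
      f1i f1z f2i m2 f3i m4 iG iGp2 hIBP (fun z => by ring) (fun z => by ring)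
    simp only [neg_mul, sub_neg_eq_add] at key
    linarith [key]
  · -- off-diagonal: `e_x` does not involve `p_y`
    rw [if_neg hxy, zero_mul, neg_zero]
    obtain ⟨f4i, f5i, hIBP⟩ := pinnedChain_integral_indep_sq_momentum_mul_gibbsDensity hω hl hβ γ N hT y
      (F := fun z : PhaseSpace N => z.2 x ^ 2 / 2 + (pinnedChain ω₂ lam β γ).U (z.1 x) + ∑ j : Fin N,
        ((if j.val = x.val + 1 then (pinnedChain ω₂ lam β γ).V (z.1 j - z.1 x) / 2 else 0) +
          (if x.val = j.val + 1 then (pinnedChain ω₂ lam β γ).V (z.1 x - z.1 j) / 2 else 0)))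
      (pinnedChain_continuous_splitSiteEnergy ω₂ lam β γ N x) (C := (N : ℝ) + 2) (by positivity)
      (fun z => by
        rw [abs_of_nonneg (pinnedChain_splitSiteEnergy_nonneg hω.le hl hβ γ N x z)]
        refine (pinnedChain_splitSiteEnergy_le hω.le hl hβ γ N x z).trans ?_
        have : (0 : ℝ) ≤ (N : ℝ) + 2 := by positivity
        nlinarith [mul_nonneg this (hH0 z)])
      (fun z t => by simp [Function.update_of_ne hxy])
    exact offDiagonal_combination f1i f1z f4i f5i hIBP

end Pinned

/-- **`ParityStatics`** (item stmt-AtomisticToContinuum-12699 of route `HonestZwanzig`): under the Gibbs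
measure `μ = gibbsMeasure N T` of `pinnedChain ω₂ lam β γ` (all parameters `> 0`, `T > 0`, `N ≥ 2`),
for the symmetrically split site energies `e_x`:
(i) `∫ e_x j_b dμ = 0` for all `x, b` (momentum parity), and
(ii) `∫ e_x (L e_y) dμ - (∫ e_x dμ)(∫ L e_y dμ) = -γT²·[x = y ∈ {0, N-1}]` (parity kills the currents,
`μ(L e_y) = 0`, and `Cov(e_x, γ(T - p_y²)) = -[x = y] γ Var(p_y²)/2 = -[x = y] γT²`; for `N ≥ 2` a site
touches at most one bath). [Bonetto–Lebowitz–Rey-Bellet 2000, §4.1, §5.2; Chu–Li 2019, §3 Thm 3]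
[folklore] -/
theorem parityStatics_proof :
    Summit.AtomisticToContinuum.FouriersLaw.Theses.HonestZwanzig.ParityStatics := by
  intro ω₂ lam β γ hω hl hβ _hγ T hT N hN
  dsimp only
  intro x
  refine ⟨fun b => ?_, fun y => ?_⟩
  · -- (i) momentum parity
    rw [OscillatorChain.integral_gibbsMeasure,
      pinnedChain_integral_even_mul_odd_mul_gibbsDensity ω₂ lam β γ N T
        (E := fun z : PhaseSpace N => z.2 x ^ 2 / 2 + (pinnedChain ω₂ lam β γ).U (z.1 x) +
          ∑ j : Fin N, ((if j.val = x.val + 1 then (pinnedChain ω₂ lam β γ).V (z.1 j - z.1 x) / 2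
            else 0) + (if x.val = j.val + 1 then (pinnedChain ω₂ lam β γ).V (z.1 x - z.1 j) / 2 else 0)))
        (J := (pinnedChain ω₂ lam β γ).bondCurrent N b)
        (fun z => splitSiteEnergy_neg_momentum _ N x z)
        (fun z => OscillatorChain.bondCurrent_neg_momentum _ N b z), mul_zero]
  · -- (ii) the covariance with `L e_y`
    rw [OscillatorChain.integral_gibbsMeasure, OscillatorChain.integral_gibbsMeasure,
      OscillatorChain.integral_gibbsMeasure,
      pinnedChain_integral_generator_splitSiteEnergy_mul_gibbsDensity hω hl.le hβ.le γ N hT y,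
      pinnedChain_integral_splitSiteEnergy_mul_generator_mul_gibbsDensity hω hl.le hβ.le γ N hT x y,
      mul_zero, mul_zero, sub_zero]
    have hZ : 0 < ∫ z, (pinnedChain ω₂ lam β γ).gibbsDensity N T z :=
      integral_exp_pos (pinnedChain_integrable_gibbsDensity hω hl.le hβ.le γ N hT)
    have hZne : (∫ z, (pinnedChain ω₂ lam β γ).gibbsDensity N T z) ≠ 0 := hZ.ne'
    have hxN := x.isLt
    rcases eq_or_ne x y with hxy | hxy
    · subst hxy
      rw [if_pos (rfl : x = x)]
      by_cases hb : x.val = 0 ∨ x.val = N - 1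
      · rw [if_pos (show x = x ∧ (x.val = 0 ∨ x.val = N - 1) from ⟨rfl, hb⟩)]
        have hc₀ : ((if x.val = 0 then (1 : ℝ) else 0) + (if x.val = N - 1 then (1 : ℝ) else 0)) = 1 := by
          rcases hb with h | h
          · have h' : ¬ (x.val = N - 1) := by omega
            rw [if_pos h, if_neg h']
            norm_num
          · have h' : ¬ (x.val = 0) := by omega
            rw [if_neg h', if_pos h]
            norm_num
        rw [hc₀]
        field_simp
      · rw [if_neg (show ¬ (x = x ∧ (x.val = 0 ∨ x.val = N - 1)) from fun h => hb h.2)]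
        have h0 : ¬ (x.val = 0) := fun h => hb (Or.inl h)
        have h1 : ¬ (x.val = N - 1) := fun h => hb (Or.inr h)
        rw [if_neg h0, if_neg h1]
        simp
    · rw [if_neg hxy, if_neg (show ¬ (x = y ∧ (x.val = 0 ∨ x.val = N - 1)) from fun h => hxy h.1)]
      simp

end Summit.AtomisticToContinuum.FouriersLaw.Theorems.HonestZwanzig

end
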